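import Summits.NavierStokesRegularity.NavierStokesRegularity.Theorems.OddMorawetzOddMorawetzLocalWeightThree
import Summits.NavierStokesRegularity.NavierStokesRegularity.Theorems.OddMorawetzOddMorawetzLocalValues3
import Summits.NavierStokesRegularity.NavierStokesRegularity.Theorems.OddMorawetzOddMorawetzLocalEvaluatorSound
import Summits.NavierStokesRegularity.NavierStokesRegularity.Theorems.OddMorawetzLocal.Negative.OddMorawetzLocalEvaluatorDefs
import Summits.NavierStokesRegularity.NavierStokesRegularity.Theorems.OddMorawetzDefs
import HarnessLib

/-!
# Crux `OddMorawetzLocal` (stmt-NavierStokesRegularity-1376) — weight 3: no certificate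

An `O(3)`-fixed weight-3 coefficient vector whose Morawetz pairing is nonnegative on all divergence-free Schwartz fields
has identically vanishing pairing: by `weight_three_live` the pairing is `γ · Q_R`, and the kernel values of `Q_R` at
the two explicit odd fields `u₁ = (−2x₁, 2x₀, 0)e^{-|x|²}`, `u₂ = (−2x₀²x₁, −2x₀+2x₀³, 0)e^{-|x|²}` are
`−π√π/20 < 0 < 2686217 π√π/246005760` (`val3_R_*` + the evaluator's soundness `morawetzPairing_pgv_eq`), forcing `γ = 0`.
Everything is proved; no definitions; no named facts.
-/

noncomputable section

set_option linter.dupNamespace false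

namespace Summit.NavierStokesRegularity.NavierStokesRegularity.Theorems.OddMorawetz

open MeasureTheory Literature.Analysis.FluidPDE

/-- **Weight 3 carries no Morawetz certificate**: an `O(3)`-fixed weight-3 coefficient vector with nonnegative
Morawetz pairing on all divergence-free Schwartz fields has identically vanishing pairing. -/
theorem no_certificate_weight_three (τ : V 3)
    (hfix : ∀ G ∈ Matrix.unitaryGroup (Fin 3) ℝ, (actMatrix 3 (G : Matrix (Fin 3) (Fin 3) ℝ)).mulVec τ = τ)
    (hnn : ∀ v, IsSchwartzField v → VectorCalculus.IsDivFree v → 0 ≤ morawetzPairing 3 v τ) :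
    ∀ v, IsSchwartzField v → VectorCalculus.IsDivFree v → morawetzPairing 3 v τ = 0 := by
  obtain ⟨γ, hγ⟩ := weight_three_live τ hfix
  have hlen : isoDesc3.length = 17 := cert3_sizes.2.2.1
  have hmem : isoDesc3.getD 0 (.poly []) ∈ isoDesc3 := by
    rw [List.getD_eq_getElem _ _ (by rw [hlen]; norm_num)]
    exact List.getElem_mem _
  have hR : ∀ t ∈ isoPolyF (isoDesc3.getD 0 (.poly [])), t.2 ∈ idx 3 := by
    have h := cert3_iso_canonical
    rw [List.all_eq_true] at h
    exact mem_idx_of_canonical_check 3 _ (h _ hmem)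
  have hpw := isoPolyF_pairwise_ne (isoDesc3.getD 0 (.poly []))
  have hRlen : (isoPolyF (isoDesc3.getD 0 (.poly []))).length ≤ 18 * 1 := by
    have : (isoPolyF (isoDesc3.getD 0 (.poly []))).length = 17 := by decide +kernel
    omega
  -- the two values
  obtain ⟨hv₁, hd₁, hQ₁⟩ := morawetzPairing_pgv_eq 3 _ hR hpw (![[(-2, 0, 1, 0)], [(2, 1, 0, 0)], []] : EField) 1000 18 1
    (fun _ => (-1/20 : ℚ)) one_pos hRlen (fun j hj => by
      interval_cases j
      simpa using val3_R_u1_0)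
  obtain ⟨hv₂, hd₂, hQ₂⟩ := morawetzPairing_pgv_eq 3 _ hR hpw (![[(-2, 2, 1, 0)], [(-2, 1, 0, 0), (2, 3, 0, 0)], []] : EField) 1000 18 1
    (fun _ => (2686217/246005760 : ℚ)) one_pos hRlen (fun j hj => by
      interval_cases j
      simpa using val3_R_u2_0)
  have h₁ := hnn _ hv₁ hd₁
  have h₂ := hnn _ hv₂ hd₂
  rw [hγ _ hv₁ hd₁, hQ₁] at h₁
  rw [hγ _ hv₂ hd₂, hQ₂] at h₂
  simp only [Finset.sum_range_one] at h₁ h₂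
  push_cast at h₁ h₂
  have hc : 0 < Real.pi * Real.sqrt Real.pi := mul_pos Real.pi_pos (Real.sqrt_pos.2 Real.pi_pos)
  have hγ0 : γ = 0 := by nlinarith
  intro v hv hd
  rw [hγ v hv hd, hγ0, zero_mul]

end Summit.NavierStokesRegularity.NavierStokesRegularity.Theorems.OddMorawetz

end
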